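import Summits.QuantumAdvantage.QuantumAdvantage.Theorems.LinnikCubicClassGroupsDegreeOnePrimesEscapeRayClassLinnik
import Summits.QuantumAdvantage.QuantumAdvantage.Theorems.LinnikCubicClassGroupsDegreeOnePrimesEscapeRayClassCounting
import Summits.QuantumAdvantage.QuantumAdvantage.Theorems.LinnikCubicClassGroupsDegreeOnePrimesEscapeClassPNTDHNumerics
import Literature.NumberTheory.LFunctions.UniformClassGroupPNTTransferMain
import Literature.NumberTheory.LFunctions.UniformClassGroupPNTTransfer
import Literature.NumberTheory.LFunctions.LogIntegralProofs
import HarnessLib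

/-!
# Linnik's theorem for cosets of a congruence class group, IX: the prime ideal theorem for cosets in
# `π`-form with relative error in the Linnik range

Topic `Summits/QuantumAdvantage/QuantumAdvantage/Theorems`, cell B2b-1 (linnik-cubic), PART A (gen 23); helper toward
the crux `DegreeOnePrimesEscape` (stmt-QuantumAdvantage-11543) of route `LinnikCubicClassGroups`.  HONEST FRAMING: the
value of this file is a THEOREM (kernel-checked, GRH-free, Siegel-free) — NOT summit progress (the route still rests on
the hypothesis-type target `PureCubicClassNumberHard`).

For a number field `K` of degree `n > 1`, an abelian Frobenius datum `f : 𝔭 ↦ f 𝔭 ∈ G` killing the narrow ray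
`mod 𝔪 ≠ 0` whose non-trivial characters are non-principal off `𝔪` (a congruence class group `H mod 𝔪`, `G = J^𝔪/H`;
canonical case `G = Cl_K^𝔪`, `f = primeRayClass`), with `|G| ≤ Q_𝔪⁴`, `Q_𝔪 = |d_K| n^n N𝔪` (`rayCondQ`), write
`π_τ(x) = #{𝔭 : N𝔭 ≤ x, 𝔭 ∤ 𝔪, f 𝔭 = τ}` (counted on the primes `v : HeightOneSpectrum (𝓞 K)`; file VIII
`…RayClassCounting` supplies `π_τ(x) = θ_τ(x)/log x + ∫₂ˣ θ_τ(t) dt/(t log² t)` and the Chebyshev bound).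
* `fiberPrimeCount_relative` — **the prime ideal theorem for cosets in `π`-form with RELATIVE error in the Linnik
  range** (Thorner–Zaman 2017 Thm 3.1 / 2019 Thm 1.4 shape for an abelian extension, degree-dependent exponent): for
  `ε > 0` there are `L = L(n,ε)`, `0 < c ≤ 1/(8(n²+1))` with: EITHER `|π_τ(x) − Li(x)/|G|| ≤ ε Li(x)/|G|` for all
  `x ≥ Q_𝔪^L` and all `τ`, OR a real character `ψ₁` of `G` has a real zero `β₁ ∈ (1 − c/(log(|d_K|N𝔪)+log 4), 1)` of
  its Hecke `L`-function and `|π_τ(x) − G_τ(x)/|G|| ≤ ε G_τ(x)/|G|` with `G_τ(x) = Li(x) − ψ₁(τ) Li(x^{β₁}) > 0`;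
* `rayClassPrimeCount_relative` — the canonical case `G = Cl_K^𝔪` with the size hypothesis discharged
  (`natCard_rayClassGroup_le_rayCondQ_pow`).
Ingredients: the `θ_τ`-form `thetaFiber_relative` (file VII), the partial summation of file VIII, the effective repulsion `rayRealZero_repulsion`
(`c₁(n) Q_𝔪^{−8} ≤ 1 − β₁`), the tree's relative-error partial summation `abs_sub_exceptionalLiMain_le`, and
`G_τ(x) ≥ (x − x^{β₁}/β₁)/log x ≥ x·min(1,(1−β₁)log x)/(4 log x) ≥ c₁ x Q_𝔪^{−8}/(4 log x)`.
References: J. Thorner, A. Zaman, ANT 11 (2017), Thm 3.1 [ThornerZaman2017]; ANT 13 (2019), Thm 1.4, §5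
[ThornerZaman2019]; A. Weiss, J. reine angew. Math. 338 (1983), §6 [Weiss1983].
-/

noncomputable section

open Complex Real MeasureTheory Set Filter Topology NumberField IsDedekindDomain
open scoped NumberField nonZeroDivisors

namespace Summit.QuantumAdvantage.QuantumAdvantage.Theorems.DegreeOnePrimesEscape

open Literature.NumberTheory.LFunctions Literature.NumberTheory.LFunctions.NumberField
  Literature.NumberTheory.LFunctions.AbelianDensity Literature.NumberTheory.GaloisRepresentations
open scoped Classical



/-! ### The prime ideal theorem for cosets in `π`-form with relative error -/

set_option maxHeartbeats 1600000 in
/-- **The prime ideal theorem for the cosets of a congruence class group in `π`-form with RELATIVE error in the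
Linnik range, unconditional** (see the module docstring). [cite: ThornerZaman2017, Theorem 3.1]
[cite: ThornerZaman2019, Theorem 1.4] [cite: Weiss1983, §6] -/
theorem fiberPrimeCount_relative (n : ℕ) (hn : 1 < n) {ε : ℝ} (hε : 0 < ε) :
    ∃ L c : ℝ, 1 ≤ L ∧ 0 < c ∧ c ≤ 1 / (8 * ((n : ℝ) ^ 2 + 1)) ∧
    ∀ (K : Type) [Field K] [NumberField K], Module.finrank ℚ K = n →
    ∀ (G : Type) [CommGroup G] [Finite G] (𝔪 : Ideal (𝓞 K)) (f : HeightOneSpectrum (𝓞 K) → G)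
      (h𝔪 : 𝔪 ≠ ⊥) (hray : ArtinKillsRay 𝔪 f)
      (hsep : ∀ χ : AddChar (Additive G) ℂ, χ ≠ 0 →
        ∃ v : HeightOneSpectrum (𝓞 K), ¬ 𝔪 ≤ v.asIdeal ∧ χ (Additive.ofMul (f v)) ≠ 1),
      (Nat.card G : ℝ) ≤ rayCondQ K 𝔪 ^ (4 : ℕ) →
      (∀ x : ℝ, rayCondQ K 𝔪 ^ L ≤ x → ∀ τ : G,
          |(({v : HeightOneSpectrum (𝓞 K) | ¬ 𝔪 ≤ v.asIdeal ∧ f v = τ ∧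
              (Ideal.absNorm v.asIdeal : ℝ) ≤ x}.ncard : ℕ) : ℝ) -
              offsetLogIntegral x / Nat.card G| ≤ ε * offsetLogIntegral x / Nat.card G) ∨
      ∃ (ψ₁ : AddChar (Additive G) ℂ) (β₁ : ℝ), rayFamF h𝔪 hray hsep ψ₁ β₁ = 0 ∧
          1 - c / (Real.log (((discr K).natAbs : ℝ) * ((Ideal.absNorm 𝔪 : ℕ) : ℝ)) + Real.log 4) < β₁ ∧ β₁ < 1 ∧
          ψ₁ + ψ₁ = 0 ∧
          ∀ x : ℝ, rayCondQ K 𝔪 ^ L ≤ x → ∀ τ : G,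
            0 < offsetLogIntegral x - (ψ₁ (Additive.ofMul τ)).re * offsetLogIntegral (x ^ β₁) ∧
            |(({v : HeightOneSpectrum (𝓞 K) | ¬ 𝔪 ≤ v.asIdeal ∧ f v = τ ∧
                (Ideal.absNorm v.asIdeal : ℝ) ≤ x}.ncard : ℕ) : ℝ) -
                (offsetLogIntegral x - (ψ₁ (Additive.ofMul τ)).re * offsetLogIntegral (x ^ β₁)) / Nat.card G| ≤
              ε * (offsetLogIntegral x - (ψ₁ (Additive.ofMul τ)).re * offsetLogIntegral (x ^ β₁)) /
                Nat.card G := by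
  have hε60 : 0 < ε / 60 := by positivity
  obtain ⟨a₂, c, ha₂1, hc, hcn, hθ⟩ := thetaFiber_relative n hn hε60
  obtain ⟨c₁, hc₁, hc₁1, hrep⟩ := rayRealZero_repulsion n hn
  have hn2 : (2 : ℝ) ≤ n := by exact_mod_cast hn
  set Λ : ℝ := max 0 (Real.log (640 / (ε * c₁))) with hΛ
  have hΛ0 : 0 ≤ Λ := le_max_left _ _
  set a₃ : ℝ := max (max (2 * a₂) 52) (52 + 4 * Λ) with ha₃
  have ha₃a₂ : 2 * a₂ ≤ a₃ := le_trans (le_max_left _ _) (le_max_left _ _)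
  have ha₃52 : (52 : ℝ) ≤ a₃ := le_trans (le_max_right _ _) (le_max_left _ _)
  have ha₃Λ : 52 + 4 * Λ ≤ a₃ := le_max_right _ _
  refine ⟨a₃, c, by linarith, hc, hcn, fun K _ _ hKn G _ _ 𝔪 f h𝔪 hray hsep hG ↦ ?_⟩
  have hK : 1 < Module.finrank ℚ K := by rw [hKn]; exact hn
  set R : ℝ := rayCondQ K 𝔪 with hR
  have hR12 : (12 : ℝ) ≤ R := twelve_le_rayCondQ hK h𝔪
  have hR1 : (1 : ℝ) < R := by linarith
  have hR0 : (0 : ℝ) < R := by linarith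
  have hRne : R ≠ 0 := hR0.ne'
  have hlogR : 2 ≤ Real.log R := two_lt_log_twelve.le.trans (Real.log_le_log (by norm_num) hR12)
  set h : ℝ := (Nat.card G : ℝ) with hh
  have hh1 : 1 ≤ h := by
    rw [hh]; exact_mod_cast Nat.one_le_iff_ne_zero.2 (Nat.card_pos (α := G)).ne'
  have hh0 : 0 < h := by linarith
  have hhQ : h ≤ R ^ 4 := hG
  have hnQ : (n : ℝ) ≤ R := by
    have h1 := ThornerZaman.finrank_le_condQn (K := K)
    rw [hKn] at h1
    exact h1.trans (condQn_le_rayCondQ h𝔪)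
  have hRm8' : 0 < R ^ (-(8 : ℝ)) := Real.rpow_pos_of_pos hR0 _
  have hRm8 : R ^ (-(8 : ℝ)) ≤ 1 := Real.rpow_le_one_of_one_le_of_nonpos hR1.le (by norm_num)
  set m' : ℝ := c₁ * R ^ (-(8 : ℝ)) with hm'
  have hm'0 : 0 < m' := mul_pos hc₁ hRm8'
  have hm'1 : m' ≤ 1 := (mul_le_mul hc₁1 hRm8 hRm8'.le zero_le_one).trans (by norm_num)
  have hm'2 : m' = c₁ * (R ^ 8)⁻¹ := by
    rw [hm', Real.rpow_neg hR0.le]; norm_cast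
  -- Chebyshev: `θ_τ(t) ≤ θ_K(t) ≤ B t`
  set B : ℝ := (n : ℝ) * (Real.log 4 + 4) with hBdef
  have hlog40 : 0 ≤ Real.log 4 := Real.log_nonneg (by norm_num)
  have hB0 : 0 ≤ B := by positivity
  have hB6 : B ≤ 6 * R := by
    have hlog4 : Real.log 4 < 2 := by
      have : Real.log 4 = 2 * Real.log 2 := by
        rw [show (4:ℝ) = 2 ^ 2 by norm_num, Real.log_pow]; norm_num
      rw [this]; have := Real.log_two_lt_d9; linarith
    have hn0 : (0:ℝ) ≤ n := Nat.cast_nonneg _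
    have : (n : ℝ) * (Real.log 4 + 4) ≤ n * 6 := mul_le_mul_of_nonneg_left (by linarith) hn0
    rw [hBdef]; nlinarith
  -- sizes at `x ≥ R^{a₃}` and the junk inequality
  set y : ℝ := R ^ a₂ with hy
  have hy1 : 1 ≤ y := Real.one_le_rpow hR1.le (by linarith)
  have hy2 : 2 ≤ y := by
    have := Real.rpow_le_rpow_of_exponent_le hR1.le ha₂1
    rw [Real.rpow_one] at this; rw [hy]; linarith
  have hnum : ∀ x : ℝ, R ^ a₃ ≤ x → 256 ≤ x ∧ y ^ 2 ≤ x ∧ 16 ≤ Real.log x ∧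
      (∀ G' : ℝ, x * m' / (4 * h * Real.log x) ≤ G' / h →
        (3 * B + 19 / h) * Real.sqrt x ≤ ε / 2 * (G' / h)) := by
    intro x hx
    have hxQ : R ≤ x := by
      have := Real.rpow_le_rpow_of_exponent_le hR1.le (show (1:ℝ) ≤ a₃ by linarith)
      rw [Real.rpow_one] at this; exact this.trans hx
    have hx1 : 1 < x := by linarith
    have hx0 : 0 < x := by linarith
    have hLx : a₃ * Real.log R ≤ Real.log x := by
      have := Real.log_le_log (by positivity) hx
      rwa [Real.log_rpow hR0] at this
    have hL16 : 16 ≤ Real.log x := by nlinarith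
    have hlogx0 : 0 < Real.log x := by linarith
    -- `x ≥ 256`: `log x ≥ 16 > log 256`
    have hx256 : (256 : ℝ) ≤ x := by
      by_contra hlt
      rw [not_le] at hlt
      have h1 : Real.log x < Real.log 256 := Real.log_lt_log hx0 hlt
      have h2 : Real.log 256 ≤ 256 - 1 := Real.log_le_sub_one_of_pos (by norm_num)
      have h3 : Real.log (256 : ℝ) = 8 * Real.log 2 := by
        rw [show (256 : ℝ) = 2 ^ 8 by norm_num, Real.log_pow]; norm_num
      have := Real.log_two_lt_d9
      linarith
    have hy2x : y ^ 2 ≤ x := by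
      rw [hy, ← Real.rpow_natCast, ← Real.rpow_mul hR0.le]
      refine le_trans (Real.rpow_le_rpow_of_exponent_le hR1.le ?_) hx
      push_cast; linarith
    refine ⟨hx256, hy2x, hL16, fun G' hG' ↦ ?_⟩
    -- `u = x^{1/4}`: `√x = u²`, `x = u⁴`, `log x ≤ 4u`, and `640 R¹³/(ε c₁) ≤ u`
    set u : ℝ := x ^ ((1 : ℝ) / 4) with hu
    have hu0 : 0 < u := Real.rpow_pos_of_pos hx0 _
    have hsx : Real.sqrt x = u ^ 2 := by
      rw [Real.sqrt_eq_rpow, hu, ← Real.rpow_natCast, ← Real.rpow_mul hx0.le]; norm_num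
    have hx4 : x = u ^ 4 := by
      rw [hu, ← Real.rpow_natCast, ← Real.rpow_mul hx0.le]; norm_num
    have hlogu : Real.log x ≤ 4 * u := by
      have h1 : Real.log x = 4 * Real.log u := by
        rw [hu, Real.log_rpow hx0]; ring
      have h2 := Real.log_le_sub_one_of_pos hu0
      linarith
    have hth := mul_rpow_neg_le_one_of_threshold (k := 13) (M := 640 / (ε * c₁)) (ν := 1 / 4) hR12 hx
      (by norm_num) (by positivity) (by rw [← hΛ]; linarith)
    have hQ13 : R ^ (13 : ℝ) = R ^ 13 := by norm_cast
    have huinv : x ^ (-(1 / 4 : ℝ)) = u⁻¹ := by rw [hu, Real.rpow_neg hx0.le]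
    rw [hQ13, huinv] at hth
    have hMu : 640 / (ε * c₁) * R ^ 13 ≤ u := by
      have := mul_le_mul_of_nonneg_right hth hu0.le
      rwa [mul_assoc, inv_mul_cancel₀ hu0.ne', mul_one, one_mul] at this
    have hkey : 640 * R ^ 13 ≤ ε * c₁ * u := by
      have := mul_le_mul_of_nonneg_left hMu (by positivity : (0 : ℝ) ≤ ε * c₁)
      have e : ε * c₁ * (640 / (ε * c₁) * R ^ 13) = 640 * R ^ 13 := by field_simp
      linarith
    -- `(3B + 19/h)√x ≤ 20 R u²`
    have hJ : (3 * B + 19 / h) * Real.sqrt x ≤ 20 * R * u ^ 2 := by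
      rw [hsx]
      have h19 : 19 / h ≤ 19 := by rw [div_le_iff₀ hh0]; nlinarith
      have : 3 * B + 19 / h ≤ 20 * R := by linarith
      exact mul_le_mul_of_nonneg_right this (by positivity)
    -- `20 R u² ≤ (ε/2) · x m'/(4 h log x)`
    have hden : 0 < 4 * h * Real.log x := by positivity
    have hRR : 20 * R * u ^ 2 ≤ ε / 2 * (x * m' / (4 * h * Real.log x)) := by
      rw [show ε / 2 * (x * m' / (4 * h * Real.log x)) = ε / 2 * (x * m') / (4 * h * Real.log x) by ring,
        le_div_iff₀ hden]
      -- `20 R u² (4 h log x) ≤ 320 R⁵ u³ ≤ (ε/2) u⁴ c₁ / R⁸ = (ε/2) x m'`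
      have h1 : 20 * R * u ^ 2 * (4 * h * Real.log x) ≤ 20 * R * u ^ 2 * (4 * R ^ 4 * (4 * u)) := by
        refine mul_le_mul_of_nonneg_left ?_ (by positivity)
        exact mul_le_mul (mul_le_mul_of_nonneg_left hhQ (by norm_num)) hlogu hlogx0.le (by positivity)
      have h2 : 20 * R * u ^ 2 * (4 * R ^ 4 * (4 * u)) = 320 * R ^ 5 * u ^ 3 := by ring
      have h3 : 320 * R ^ 5 * u ^ 3 ≤ ε / 2 * (x * m') := by
        rw [hx4, hm'2]
        have e : ε / 2 * (u ^ 4 * (c₁ * (R ^ 8)⁻¹)) = (ε * c₁ * u) * u ^ 3 / (2 * R ^ 8) := by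
          field_simp
        rw [e, le_div_iff₀ (by positivity)]
        have h4 := mul_le_mul_of_nonneg_right hkey (by positivity : (0 : ℝ) ≤ u ^ 3)
        have e2 : 320 * R ^ 5 * u ^ 3 * (2 * R ^ 8) = 640 * R ^ 13 * u ^ 3 := by ring
        rw [e2]; exact h4
      linarith
    calc (3 * B + 19 / h) * Real.sqrt x ≤ 20 * R * u ^ 2 := hJ
      _ ≤ ε / 2 * (x * m' / (4 * h * Real.log x)) := hRR
      _ ≤ ε / 2 * (G' / h) := mul_le_mul_of_nonneg_left hG' (by positivity)
  -- Chebyshev bound and integrability for `θ_τ`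
  have hTB : ∀ (τ : G) (t : ℝ), 2 ≤ t → fiberTheta 𝔪 f τ t ≤ B * t := by
    intro τ t ht
    have := fiberTheta_le_mul (𝔪 := 𝔪) (f := f) τ (t := t) (by linarith)
    rw [hKn] at this
    rw [hBdef]; exact this
  rcases hθ K hKn G 𝔪 f h𝔪 hray hsep hG with hgood | ⟨ψ₁, β₁, hz, hβlow, hβ1, hreal, hexc⟩
  · -- no exceptional zero: `G = Li(x)`
    left
    intro x hx τ
    obtain ⟨hx256, hy2x, hL16, hjunk⟩ := hnum x hx
    have hx2 : (2 : ℝ) ≤ x := by linarith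
    have hx1 : (1 : ℝ) < x := by linarith
    have hx0 : 0 < x := by linarith
    have hlogx0 : 0 < Real.log x := Real.log_pos hx1
    have key := abs_sub_exceptionalLiMain_le (T := fiberTheta 𝔪 f τ) (E := fun _ ↦ (1 : ℝ))
      (P := (({v : HeightOneSpectrum (𝓞 K) | ¬ 𝔪 ≤ v.asIdeal ∧ f v = τ ∧
        (Ideal.absNorm v.asIdeal : ℝ) ≤ x}.ncard : ℕ) : ℝ))
      (θ₁ := 0) (β := 1) (A := ε / 60) (B := B) (y := y)
      hh0 (by simp) (by norm_num) le_rfl hε60.le hB0 hy2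
      (fun t _ ↦ fiberTheta_nonneg τ t) (hTB τ) (antitoneOn_const) (fun _ _ ↦ zero_le_one)
      (fun t ht ↦ by
        have h1 := hgood t (by rw [← hR]; exact ht) τ
        have e : t - 0 * t ^ (1 : ℝ) / 1 = t := by simp
        rw [e]
        calc |fiberTheta 𝔪 f τ t - t / h| ≤ ε / 60 * t / h := h1
          _ = ε / 60 * 1 * (t / h) := by ring)
      hx256 hy2x (intervalIntegrable_fiberTheta_div τ hx2)
      (fiberPrimeCount_eq_theta_div_log_add_integral τ hx2)
    simp only [zero_mul, sub_zero, mul_one] at key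
    -- lower bound `Li(x)/h ≥ x m'/(4 h log x)`
    have hLi : x * m' / (4 * h * Real.log x) ≤ offsetLogIntegral x / h := by
      have h1 := sub_mul_inv_log_pow_le_offsetLogIntegralPow 1 hx2
      rw [pow_one, offsetLogIntegralPow_one] at h1
      have h2 : x * m' / (4 * Real.log x) ≤ (x - 2) * (Real.log x)⁻¹ := by
        rw [div_le_iff₀ (by positivity)]
        have : x * m' ≤ x * 1 := mul_le_mul_of_nonneg_left hm'1 hx0.le
        have e : (x - 2) * (Real.log x)⁻¹ * (4 * Real.log x) = 4 * (x - 2) := by field_simp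
        rw [e]; nlinarith
      have h3 : x * m' / (4 * h * Real.log x) = (x * m' / (4 * Real.log x)) / h := by
        field_simp
      rw [h3]
      exact div_le_div_of_nonneg_right (h2.trans h1) hh0.le
    have hJ := hjunk (offsetLogIntegral x) hLi
    have e30 : 30 * (ε / 60) * (offsetLogIntegral x / h) = ε / 2 * (offsetLogIntegral x / h) := by ring
    rw [e30] at key
    have : |(({v : HeightOneSpectrum (𝓞 K) | ¬ 𝔪 ≤ v.asIdeal ∧ f v = τ ∧
        (Ideal.absNorm v.asIdeal : ℝ) ≤ x}.ncard : ℕ) : ℝ) -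
          offsetLogIntegral x / h| ≤ ε * (offsetLogIntegral x / h) := by
      linarith
    simpa [mul_div_assoc] using this
  · -- the exceptional zero
    right
    have hβ34 : 3 / 4 ≤ β₁ := by
      have hlog4 : 1 < Real.log 4 := by
        rw [show (4:ℝ) = 2 ^ 2 by norm_num, Real.log_pow]; have := Real.log_two_gt_d9; push_cast; linarith
      have hlogd : 0 ≤ Real.log (((discr K).natAbs : ℝ) * ((Ideal.absNorm 𝔪 : ℕ) : ℝ)) :=
        Real.log_nonneg (one_le_discr_mul_absNorm K h𝔪)
      have hc4 : c ≤ 1 / 4 := by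
        refine hcn.trans ?_
        rw [div_le_div_iff_of_pos_left one_pos (by positivity) (by norm_num)]
        have := sq_nonneg (n : ℝ); linarith
      have : c / (Real.log (((discr K).natAbs : ℝ) * ((Ideal.absNorm 𝔪 : ℕ) : ℝ)) + Real.log 4) ≤ 1 / 4 := by
        rw [div_le_iff₀ (by linarith)]; nlinarith
      linarith
    have hβhalf : 1 / 2 < β₁ := by linarith
    refine ⟨ψ₁, β₁, hz, hβlow, hβ1, hreal, fun x hx τ ↦ ?_⟩
    obtain ⟨hx256, hy2x, hL16, hjunk⟩ := hnum x hx
    have hx2 : (2 : ℝ) ≤ x := by linarith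
    have hx1 : (1 : ℝ) < x := by linarith
    have hx0 : 0 < x := by linarith
    have hlogx0 : 0 < Real.log x := Real.log_pos hx1
    have hlogx1 : 1 ≤ Real.log x := by linarith
    set r : ℝ := (ψ₁ (Additive.ofMul τ)).re with hr
    have hrabs : |r| ≤ 1 := (addChar_real_apply hreal (Additive.ofMul τ)).2.2
    have key := abs_sub_exceptionalLiMain_le (T := fiberTheta 𝔪 f τ) (E := fun _ ↦ (1 : ℝ))
      (P := (({v : HeightOneSpectrum (𝓞 K) | ¬ 𝔪 ≤ v.asIdeal ∧ f v = τ ∧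
        (Ideal.absNorm v.asIdeal : ℝ) ≤ x}.ncard : ℕ) : ℝ))
      (θ₁ := r) (β := β₁) (A := ε / 60) (B := B) (y := y)
      hh0 hrabs hβhalf hβ1.le hε60.le hB0 hy2
      (fun t _ ↦ fiberTheta_nonneg τ t) (hTB τ) (antitoneOn_const) (fun _ _ ↦ zero_le_one)
      (fun t ht ↦ by
        have h1 := (hexc t (by rw [← hR]; exact ht) τ).2
        calc |fiberTheta 𝔪 f τ t - (t - r * t ^ β₁ / β₁) / h| ≤
            ε / 60 * (t - r * t ^ β₁ / β₁) / h := h1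
          _ = ε / 60 * 1 * ((t - r * t ^ β₁ / β₁) / h) := by ring)
      hx256 hy2x (intervalIntegrable_fiberTheta_div τ hx2)
      (fiberPrimeCount_eq_theta_div_log_add_integral τ hx2)
    set G' : ℝ := offsetLogIntegral x - r * offsetLogIntegral (x ^ β₁) with hG'
    -- lower bound `G'/h ≥ x m'/(4 h log x)`
    have hδ : m' ≤ 1 - β₁ := hrep K hKn G 𝔪 f h𝔪 hray hsep ψ₁ hreal β₁ hβ1 hz
    have hGlow : x * m' / (4 * h * Real.log x) ≤ G' / h := by
      have hLiβ : 0 ≤ offsetLogIntegral (x ^ β₁) := by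
        have hxβ2 : (2 : ℝ) ≤ x ^ β₁ := by
          have : x ^ ((1 : ℝ) / 2) ≤ x ^ β₁ := Real.rpow_le_rpow_of_exponent_le hx1.le (by linarith)
          have h16 : (16 : ℝ) ≤ x ^ ((1 : ℝ) / 2) := by
            rw [← Real.sqrt_eq_rpow, show (16 : ℝ) = Real.sqrt 256 by
              rw [show (256 : ℝ) = 16 ^ 2 by norm_num, Real.sqrt_sq (by norm_num)]]
            exact Real.sqrt_le_sqrt hx256
          linarith
        have h0 := offsetLogIntegralPow_nonneg 1 hxβ2
        rwa [offsetLogIntegralPow_one] at h0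
      have h1 : offsetLogIntegral x - offsetLogIntegral (x ^ β₁) ≤ G' := by
        rw [hG']
        have : r * offsetLogIntegral (x ^ β₁) ≤ 1 * offsetLogIntegral (x ^ β₁) :=
          mul_le_mul_of_nonneg_right (abs_le.1 hrabs).2 hLiβ
        linarith
      have h2 := sub_rpow_div_log_le_offsetLogIntegral_sub hx1 (by linarith : 0 < β₁) hβ1.le
      have h3 : x - x ^ β₁ / β₁ ≤ x - x ^ β₁ := by
        have hxβ0 : 0 < x ^ β₁ := Real.rpow_pos_of_pos hx0 _
        have : x ^ β₁ ≤ x ^ β₁ / β₁ := by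
          rw [le_div_iff₀ (by linarith)]; nlinarith
        exact sub_le_sub_left this x
      have h4 := sub_mul_rpow_div_ge hx1 hL16 hβ34 hβ1 (show |(1 : ℝ)| ≤ 1 by simp)
      rw [one_mul] at h4
      have hmin : m' ≤ min 1 ((1 - β₁) * Real.log x) := by
        refine le_min hm'1 (hδ.trans ?_)
        have := mul_le_mul_of_nonneg_left hlogx1 (by linarith : (0 : ℝ) ≤ 1 - β₁); linarith
      have h5 : x * m' / 4 ≤ x - x ^ β₁ := by
        have := mul_le_mul_of_nonneg_left hmin (by positivity : (0 : ℝ) ≤ x / 4)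
        linarith
      have h6 : x * m' / (4 * Real.log x) ≤ (x - x ^ β₁) / Real.log x := by
        rw [show x * m' / (4 * Real.log x) = (x * m' / 4) / Real.log x by field_simp]
        exact div_le_div_of_nonneg_right h5 hlogx0.le
      have h7 : x * m' / (4 * h * Real.log x) = (x * m' / (4 * Real.log x)) / h := by field_simp
      rw [h7]
      exact div_le_div_of_nonneg_right ((h6.trans h2).trans h1) hh0.le
    have hG0 : 0 < G' := by
      have : 0 < x * m' / (4 * h * Real.log x) := by positivity
      have := this.trans_le hGlow
      exact (div_pos_iff_of_pos_right hh0).1 this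
    have hJ := hjunk G' hGlow
    refine ⟨hG0, ?_⟩
    have e30 : 30 * (ε / 60) * 1 * (G' / h) = ε / 2 * (G' / h) := by ring
    rw [e30] at key
    have : |(({v : HeightOneSpectrum (𝓞 K) | ¬ 𝔪 ≤ v.asIdeal ∧ f v = τ ∧
        (Ideal.absNorm v.asIdeal : ℝ) ≤ x}.ncard : ℕ) : ℝ) - G' / h| ≤
        ε * (G' / h) := by linarith
    simpa [hG', mul_div_assoc] using this

/-- **The prime ideal theorem for narrow ray classes in `π`-form with relative error in the Linnik range,
unconditionally** (canonical case `G = Cl_K^𝔪`, `f = primeRayClass`; the size hypothesis `|Cl_K^𝔪| ≤ Q_𝔪⁴` is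
`natCard_rayClassGroup_le_rayCondQ_pow`; the instance `Finite (RayClassGroup 𝔪)` is `finite_rayClassGroup h𝔪`). [cite: ThornerZaman2017, Theorem 3.1] [cite: Weiss1983, §6] -/
theorem rayClassPrimeCount_relative (n : ℕ) (hn : 1 < n) {ε : ℝ} (hε : 0 < ε) :
    ∃ L c : ℝ, 1 ≤ L ∧ 0 < c ∧ c ≤ 1 / (8 * ((n : ℝ) ^ 2 + 1)) ∧
    ∀ (K : Type) [Field K] [NumberField K], Module.finrank ℚ K = n →
    ∀ (𝔪 : Ideal (𝓞 K)) (h𝔪 : 𝔪 ≠ ⊥) [Finite (RayClassGroup 𝔪)],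
      (∀ x : ℝ, rayCondQ K 𝔪 ^ L ≤ x → ∀ τ : RayClassGroup 𝔪,
          |(({v : HeightOneSpectrum (𝓞 K) | ¬ 𝔪 ≤ v.asIdeal ∧ primeRayClass 𝔪 h𝔪 v = τ ∧
              (Ideal.absNorm v.asIdeal : ℝ) ≤ x}.ncard : ℕ) : ℝ) -
              offsetLogIntegral x / Nat.card (RayClassGroup 𝔪)| ≤
            ε * offsetLogIntegral x / Nat.card (RayClassGroup 𝔪)) ∨
      ∃ (ψ₁ : AddChar (Additive (RayClassGroup 𝔪)) ℂ) (β₁ : ℝ),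
          rayFamF h𝔪 (artinKillsRay_primeRayClass h𝔪)
            (fun χ hχ ↦ exists_charFun_primeRayClass_ne_one h𝔪 χ hχ) ψ₁ β₁ = 0 ∧
          1 - c / (Real.log (((discr K).natAbs : ℝ) * ((Ideal.absNorm 𝔪 : ℕ) : ℝ)) + Real.log 4) < β₁ ∧ β₁ < 1 ∧
          ψ₁ + ψ₁ = 0 ∧
          ∀ x : ℝ, rayCondQ K 𝔪 ^ L ≤ x → ∀ τ : RayClassGroup 𝔪,
            0 < offsetLogIntegral x - (ψ₁ (Additive.ofMul τ)).re * offsetLogIntegral (x ^ β₁) ∧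
            |(({v : HeightOneSpectrum (𝓞 K) | ¬ 𝔪 ≤ v.asIdeal ∧ primeRayClass 𝔪 h𝔪 v = τ ∧
                (Ideal.absNorm v.asIdeal : ℝ) ≤ x}.ncard : ℕ) : ℝ) -
                (offsetLogIntegral x - (ψ₁ (Additive.ofMul τ)).re * offsetLogIntegral (x ^ β₁)) /
                  Nat.card (RayClassGroup 𝔪)| ≤
              ε * (offsetLogIntegral x - (ψ₁ (Additive.ofMul τ)).re * offsetLogIntegral (x ^ β₁)) /
                Nat.card (RayClassGroup 𝔪) := by
  obtain ⟨L, c, hL1, hc, hcn, h⟩ := fiberPrimeCount_relative n hn hε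
  refine ⟨L, c, hL1, hc, hcn, fun K _ _ hKn 𝔪 h𝔪 _ ↦ ?_⟩
  have hK : 1 < Module.finrank ℚ K := by rw [hKn]; exact hn
  exact h K hKn (RayClassGroup 𝔪) 𝔪 (primeRayClass 𝔪 h𝔪) h𝔪 (artinKillsRay_primeRayClass h𝔪)
    (fun χ hχ ↦ exists_charFun_primeRayClass_ne_one h𝔪 χ hχ) (natCard_rayClassGroup_le_rayCondQ_pow hK h𝔪)

end Summit.QuantumAdvantage.QuantumAdvantage.Theorems.DegreeOnePrimesEscape

end
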